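import Summits.QuantumFields.BalabanUV.Beta.EriceRemainderEnclosureHistoryAutonomyComparisonLoadBudgetWindow
import Summits.QuantumFields.BalabanUV.Beta.EriceRemainderEnclosureHistoryAutonomyComparisonInvCubeConvex

/-!
# EriceRemainderEnclosureHistoryAutonomyComparisonCubeBudget — (E70b) THE WINDOW BUDGET WITH EXACT LEVEL RATIOS AND THE PIN, AND THE CUBE TRANSPORT OF OLD AGES:
# along every box solution of an isotone memory dominated by a profile `L ≥ 0`, at every scale `j`:
# **`(h_j∕h_0)² + Σ_{k<K} (L_k·k·h_k³)·(S_{k,j}∕k)·(h_j∕h_k)² ≤ 1`** (the window budget BEFORE any transport of the level ratio `(h_j∕h_k)² = a_k∕a_j`);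
# for the AFFINE memory the OLD ages `k > j` obey **`k ≤ j·(h_j∕h_k)³ + (k−j)·(h_j∕h_0)³`** ((E70a) convexity of `1∕h³`) instead of (E65a)'s `(h_j∕h_k)² ≥ 1`:
# away from the pin an old age presses on a young scale with weight `≈ (S_{k,j}∕k)·(k∕j)^{2∕3} ≈ (j∕k)^{1∕3}`, not `j∕k`

Cell `pub-balaban`, β-function sub-cell, BINDER row D4 «RemainderConst leaves for Bałaban's split» (`HOME/BINDER-OWNERS.md`; owner lineage `b2b-balaban-beta-an4`;
this file by co-owner #2 lineage `b2b-balaban-beta-d4-p2`, generation 60), β-FLOW TEAM duty (1), FREEZE (0) honoured (def-free; (E65a)'s `readWindow_nonneg`,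
(E58b)'s `mul_sqrt_le_read` ∕ `mul_invSq_add_le`, (E70a)'s `inv_cube_secant`, (E41)'s `affine_monotone` ∕ `affine_floor`, node U2's `invSq_eq_of_memFlow` ∕ `drive` ∕
`seqBox_shift` BY NAME; nothing restated).

HONEST FRAMING (page 1, verbatim and binding).  *"Discharging BetaPertH makes Bałaban's UV stability UNCONDITIONAL — a real constructive-QFT result; it is
NOT the continuum limit and NOT the Clay problem."*  THIS FILE DISCHARGES NOTHING OF THE KIND.  Elementary real analysis about ABSTRACT functionals on a box
]0,γ]^ℕ with displayed floors, profiles and signs — hypotheses of a census, not facts; the form, signs, ages and moments of Bałaban's (1.22) limit functional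
are NOT PRINTED ([I] p. 298; GAPS G-t4-U2-1∕-2) and NOT asserted.  Row D4 class UNCHANGED (critical-path width 0; instance 0∕1; D4 DISCHARGE NO DATE).  HONEST
DEPENDENCY: continuum YM on T⁴ ⇐ BetaPertH ∧ nine spine estimates (0/9 proved); BetaPertH ⇐ (D1) ∧ (D4) ∧ CAP+tail; G-an2-4 gates asym, D1 and NE2/3/4.

THE POINT (census sense (α); the COMPARISON column, conjecture (E58′), the budgeted programme (C″) of (E65b)∕(E65f)).  (E65a) `load_budget_window` reads the
level at scale `j` as the sum of its `j` increments and transports each read of age `k` to the age's own scale; the level ratio `a_k∕a_j = (h_j∕h_k)²` that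
appears was bounded by `k∕j` for `k ≤ j` (concavity) and by `1` for `k > j` (monotonicity), and the pin level `a_0 ≥ 0` was dropped.  §1 keeps both EXACTLY:
`(h_j∕h_0)² + Σ_k (L_k·k·h_k³)(S_{k,j}∕k)(h_j∕h_k)² ≤ 1`.  §2: for the affine memory, (E70a)'s convexity of `1∕h³` transports the OLD ages by
`j·(h_j∕h_k)³ + (k−j)·(h_j∕h_0)³ ≥ k` — where the pin share `(h_j∕h_0)²` is small (it is at most `1 −` the usage at `j` by §1), `(h_j∕h_k)² ≳ (k∕j)^{2∕3}`; §2 also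
records the young transport `j·(h_j∕h_k)² ≥ k` (`k ≤ j`) in the same currency and the chord `(M³−1)(r²−1) ≥ (M²−1)(r³−1)` on `1 ≤ r ≤ M` that turns a cube
ratio into a square ratio without fractional powers (`M = 2`: `r² ≥ 1 + (3∕7)(r³−1)`).  NUMERICS (`HOME/b2b-balaban-beta-d4-p2/g60/e70/README.md`, pin share `0`):
admissible UNIFORM load of a ratio-`R` tower under (E65a) → under the cube transport: `R = 2`: `0.098 → 0.065`; `R = 3`: `0.154 → 0.101`; `R = 4`: `0.191 →
0.126`; `R = 1.5`: `0.059 → 0.042` (height 30); realized saturated loads (true flows) `R = 2`: `0.111 ∕ 0.079 ∕ 0.064` at heights `6 ∕ 9 ∕ 12`.  The (λ,Z)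
relaxation of (E66)∕(E67) diverged at ratio 2 because its admissible uniform load `≥ 0.12` exceeded the λ-chain threshold `4∕31 = 0.129`; the cube transport puts
the admissible load at `0.065`.  NOT CLAIMED: any comparison theorem; anything printed.

WHAT IS PROVED ([folklore]; 0 `def`, 0 sorry).  §1 `sum_mul_readWindow_le_invSq_sub_pin` ((E65a) §1 with the pin level kept), **`levelRatio_budget_window`**.
§2 **`old_cube_transport`** (`k ≤ j(h_j∕h_k)³ + (k−j)(h_j∕h_0)³`, affine memory, `k ≥ j`), `young_level_transport` (`k ≤ j(h_j∕h_k)²`, `k ≤ j`),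
`chord_cube_sq` (`(M³−1)(r²−1) ≥ (M²−1)(r³−1)` for `1 ≤ r ≤ M`), `pinShare_le` (`(h_j∕h_0)² ≤ 1 − Σ_k (L_k k h_k³)(S_{k,j}∕k)(h_j∕h_k)²`, restated budget).
-/
noncomputable section
open Finset Set

namespace Summit.QuantumFields.BalabanUV.Beta.EriceRemainderEnclosureHistoryAutonomyComparisonCubeBudget

open Literature.MathematicalPhysics.QuantumFieldTheory.Balaban1983to89
open Literature.MathematicalPhysics.QuantumFieldTheory.Balaban1983to89.T4BetaStationary
open Literature.MathematicalPhysics.QuantumFieldTheory.Balaban1983to89.T4BetaFlowWellPosed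
open Summit.QuantumFields.BalabanUV.Beta.EriceRemainderEnclosureHistoryAutonomyComparisonAffineProfile (mul_invSq_add_le mul_sqrt_le_read)
open Summit.QuantumFields.BalabanUV.Beta.EriceRemainderEnclosureHistoryAutonomyComparisonLoadBudgetWindow (readWindow_nonneg)
open Summit.QuantumFields.BalabanUV.Beta.EriceRemainderEnclosureHistoryAutonomyComparisonInvCubeConvex (inv_cube_secant)
open Summit.QuantumFields.BalabanUV.Beta.EriceRemainderEnclosureHistoryAutonomyMonotone (affine_monotone affine_floor)

variable {B : (ℕ → ℝ) → ℝ} {γ b y : ℝ} {L : ℕ → ℝ} {K : ℕ} {h : ℕ → ℝ}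

/-! ## §1 The window budget with exact level ratios and the pin -/

/-- (E65a) §1 with the pin level kept: `B` isotone with floor `b > 0`, dominated by the profile `L ≥ 0`; along every box solution `h` from every pin `y > 0`, for
every scale `j`: `1∕h_0² + Σ_{k<K} L_k·h_k·S_{k,j} ≤ 1∕h_j²`, `S_{k,j} = Σ_{l<j} √(k∕(k+l+1))`. [folklore] -/
theorem sum_mul_readWindow_le_invSq_sub_pin (hmono : ∀ u v : ℕ → ℝ, SeqBox γ u → SeqBox γ v → (∀ j, u j ≤ v j) → B u ≤ B v)
    (hL : ∀ k, 0 ≤ L k) (hb : 0 < b) (hlo : ∀ u, SeqBox γ u → b ≤ B u) (hdom : ∀ u, SeqBox γ u → ∑ k ∈ range K, L k * u k ≤ B u)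
    (hy : 0 < y) (hh : SeqBox γ h) (hf : MemFlow B y h) (j : ℕ) :
    1 / h 0 ^ 2 + ∑ k ∈ range K, L k * h k * ∑ l ∈ range j, Real.sqrt ((k : ℝ) / ((k : ℝ) + l + 1)) ≤ 1 / h j ^ 2 := by
  rw [invSq_eq_of_memFlow hf j, hf.1]
  have hdrive : ∑ l ∈ range j, ∑ k ∈ range K, L k * h (l + 1 + k) ≤ drive B h j := by
    unfold drive
    exact sum_le_sum fun l _ => hdom _ (seqBox_shift hh (l + 1))
  have hterm : ∀ k ∈ range K, L k * h k * ∑ l ∈ range j, Real.sqrt ((k : ℝ) / ((k : ℝ) + l + 1)) ≤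
      ∑ l ∈ range j, L k * h (l + 1 + k) := by
    intro k _
    rw [mul_sum]
    refine sum_le_sum fun l _ => ?_
    have hr := mul_sqrt_le_read hmono hb hlo hy hh hf k (l + 1)
    rw [show k + (l + 1) = l + 1 + k by omega] at hr
    have e : ((k : ℝ) + ((l + 1 : ℕ) : ℝ)) = (k : ℝ) + l + 1 := by push_cast; ring
    rw [e] at hr
    calc L k * h k * Real.sqrt ((k : ℝ) / ((k : ℝ) + l + 1)) = L k * (Real.sqrt ((k : ℝ) / ((k : ℝ) + l + 1)) * h k) := by ring
      _ ≤ L k * h (l + 1 + k) := mul_le_mul_of_nonneg_left hr (hL k)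
  calc 1 / y ^ 2 + ∑ k ∈ range K, L k * h k * ∑ l ∈ range j, Real.sqrt ((k : ℝ) / ((k : ℝ) + l + 1))
      ≤ 1 / y ^ 2 + ∑ k ∈ range K, ∑ l ∈ range j, L k * h (l + 1 + k) := by linarith [sum_le_sum hterm]
    _ = 1 / y ^ 2 + ∑ l ∈ range j, ∑ k ∈ range K, L k * h (l + 1 + k) := by rw [sum_comm]
    _ ≤ 1 / y ^ 2 + drive B h j := by linarith

/-- **THE WINDOW BUDGET WITH EXACT LEVEL RATIOS AND THE PIN.**  `B` isotone with floor `b > 0`, dominated by the profile `L ≥ 0`; along every box solution `h`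
from every pin `y > 0`, for every scale `j`: **`(h_j∕h_0)² + Σ_{k<K} (L_k·k·h_k³)·(S_{k,j}∕k)·(h_j∕h_k)² ≤ 1`** — §1 multiplied by `h_j²`, the loads
`x_k = L_k·k·h_k³∕2` displayed with the EXACT ratio `(h_j∕h_k)² = a_k∕a_j` (the Markov term `k = 0` is dropped: its displayed weight is `S∕0 = 0`).  (E65a)
`load_budget_window` is this with `(h_j∕h_k)² ≥ k∕j` (`k ≤ j`), `≥ 1` (`k > j`) and the pin share dropped. [folklore] -/
theorem levelRatio_budget_window (hmono : ∀ u v : ℕ → ℝ, SeqBox γ u → SeqBox γ v → (∀ j, u j ≤ v j) → B u ≤ B v)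
    (hL : ∀ k, 0 ≤ L k) (hb : 0 < b) (hlo : ∀ u, SeqBox γ u → b ≤ B u) (hdom : ∀ u, SeqBox γ u → ∑ k ∈ range K, L k * u k ≤ B u)
    (hy : 0 < y) (hh : SeqBox γ h) (hf : MemFlow B y h) (j : ℕ) :
    (h j / h 0) ^ 2 + ∑ k ∈ range K, L k * k * h k ^ 3 * ((∑ l ∈ range j, Real.sqrt ((k : ℝ) / ((k : ℝ) + l + 1))) / k) * (h j / h k) ^ 2 ≤ 1 := by
  have hwin := sum_mul_readWindow_le_invSq_sub_pin hmono hL hb hlo hdom hy hh hf j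
  have hhj := (hh j).1
  have hh0 := (hh 0).1
  -- termwise identity / inequality: L_k k h_k³ (S/k) (h_j/h_k)² ≤ h_j² (L_k h_k S)  (equality for k ≥ 1, `0 ≤ …` for k = 0)
  have hterm : ∀ k ∈ range K, L k * k * h k ^ 3 * ((∑ l ∈ range j, Real.sqrt ((k : ℝ) / ((k : ℝ) + l + 1))) / k) * (h j / h k) ^ 2 ≤
      h j ^ 2 * (L k * h k * ∑ l ∈ range j, Real.sqrt ((k : ℝ) / ((k : ℝ) + l + 1))) := by
    intro k _
    have hhk := (hh k).1
    have hS := readWindow_nonneg k j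
    rcases Nat.eq_zero_or_pos k with hk | hk
    · subst hk
      simp only [Nat.cast_zero, mul_zero, zero_mul, div_zero]
      exact mul_nonneg (by positivity) (mul_nonneg (mul_nonneg (hL 0) hhk.le) (sum_nonneg fun _ _ => Real.sqrt_nonneg _))
    · have hkr : (0 : ℝ) < k := by exact_mod_cast hk
      apply le_of_eq
      field_simp
  calc (h j / h 0) ^ 2 + ∑ k ∈ range K, L k * k * h k ^ 3 * ((∑ l ∈ range j, Real.sqrt ((k : ℝ) / ((k : ℝ) + l + 1))) / k) * (h j / h k) ^ 2
      ≤ (h j / h 0) ^ 2 + ∑ k ∈ range K, h j ^ 2 * (L k * h k * ∑ l ∈ range j, Real.sqrt ((k : ℝ) / ((k : ℝ) + l + 1))) := by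
        linarith [sum_le_sum hterm]
    _ = h j ^ 2 * (1 / h 0 ^ 2 + ∑ k ∈ range K, L k * h k * ∑ l ∈ range j, Real.sqrt ((k : ℝ) / ((k : ℝ) + l + 1))) := by
        rw [mul_add, mul_sum]; congr 1; field_simp
    _ ≤ h j ^ 2 * (1 / h j ^ 2) := mul_le_mul_of_nonneg_left hwin (by positivity)
    _ = 1 := by field_simp

/-- The pin share is what the window leaves: `(h_j∕h_0)² ≤ 1 − Σ_{k<K} (L_k·k·h_k³)·(S_{k,j}∕k)·(h_j∕h_k)²` — a heavily used scale sits far above the pin. [folklore] -/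
theorem pinShare_le (hmono : ∀ u v : ℕ → ℝ, SeqBox γ u → SeqBox γ v → (∀ j, u j ≤ v j) → B u ≤ B v)
    (hL : ∀ k, 0 ≤ L k) (hb : 0 < b) (hlo : ∀ u, SeqBox γ u → b ≤ B u) (hdom : ∀ u, SeqBox γ u → ∑ k ∈ range K, L k * u k ≤ B u)
    (hy : 0 < y) (hh : SeqBox γ h) (hf : MemFlow B y h) (j : ℕ) :
    (h j / h 0) ^ 2 ≤ 1 - ∑ k ∈ range K, L k * k * h k ^ 3 * ((∑ l ∈ range j, Real.sqrt ((k : ℝ) / ((k : ℝ) + l + 1))) / k) * (h j / h k) ^ 2 := by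
  linarith [levelRatio_budget_window hmono hL hb hlo hdom hy hh hf j]

/-! ## §2 Transports of the level ratio: old ages by the cube, young ages by the square; the chord -/

/-- **THE CUBE TRANSPORT OF OLD AGES.**  Along every box solution of the AFFINE memory `B(u) = b + Σ_{k<K} L_k·u_k` (`b > 0`, `L ≥ 0`) from every pin, for
`j ≤ k`: **`k ≤ j·(h_j∕h_k)³ + (k−j)·(h_j∕h_0)³`** — (E70a) `inv_cube_secant` (convexity of `1∕h³`) multiplied by `h_j³`.  With the pin share `(h_j∕h_0)³ ≤ ε`:
`(h_j∕h_k)³ ≥ (k − (k−j)ε)∕j`, against (E65a)'s `(h_j∕h_k)² ≥ 1`. [folklore] -/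
theorem old_cube_transport (hL : ∀ k, 0 ≤ L k) (hb : 0 < b) (hh : SeqBox γ h)
    (hf : MemFlow (fun u : ℕ → ℝ => b + ∑ k ∈ range K, L k * u k) y h) {j k : ℕ} (hjk : j ≤ k) :
    (k : ℝ) ≤ (j : ℝ) * (h j / h k) ^ 3 + ((k : ℝ) - j) * (h j / h 0) ^ 3 := by
  have hpos : ∀ i, 0 < h i := fun i => (hh i).1
  have hsec := inv_cube_secant hb.le hL hpos hf j (k - j)
  have e : j + (k - j) = k := by omega
  have e' : ((k - j : ℕ) : ℝ) = (k : ℝ) - j := by rw [Nat.cast_sub hjk]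
  rw [e, e'] at hsec
  have hhj := hpos j; have hhk := hpos k; have hh0 := hpos 0
  -- multiply by h_j³ > 0
  have := mul_le_mul_of_nonneg_right hsec (pow_nonneg hhj.le 3)
  have e1 : ((j : ℝ) + ((k : ℝ) - j)) * (1 / h j ^ 3) * h j ^ 3 = k := by field_simp; ring
  have e2 : ((j : ℝ) * (1 / h k ^ 3) + ((k : ℝ) - j) * (1 / h 0 ^ 3)) * h j ^ 3 =
      (j : ℝ) * (h j / h k) ^ 3 + ((k : ℝ) - j) * (h j / h 0) ^ 3 := by
    field_simp
  rw [e1, e2] at this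
  exact this

/-- THE SQUARE TRANSPORT OF YOUNG AGES ((E58b) `mul_invSq_add_le` in the same currency): `B` isotone with floor `b > 0`; along every box solution from every pin
`y > 0`, for `k ≤ j`: `k ≤ j·(h_j∕h_k)²`. [folklore] -/
theorem young_level_transport (hmono : ∀ u v : ℕ → ℝ, SeqBox γ u → SeqBox γ v → (∀ j, u j ≤ v j) → B u ≤ B v) (hb : 0 < b)
    (hlo : ∀ u, SeqBox γ u → b ≤ B u) (hy : 0 < y) (hh : SeqBox γ h) (hf : MemFlow B y h) {k j : ℕ} (hkj : k ≤ j) :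
    (k : ℝ) ≤ (j : ℝ) * (h j / h k) ^ 2 := by
  have hc := mul_invSq_add_le hmono hb hlo hy hh hf k (j - k)
  have e : k + (j - k) = j := by omega
  have e' : (k : ℝ) + ((j - k : ℕ) : ℝ) = j := by exact_mod_cast e
  rw [e, e'] at hc
  have hhj := (hh j).1; have hhk := (hh k).1
  have := mul_le_mul_of_nonneg_right hc (pow_nonneg hhj.le 2)
  have e1 : (k : ℝ) * (1 / h j ^ 2) * h j ^ 2 = k := by field_simp
  have e2 : (j : ℝ) * (1 / h k ^ 2) * h j ^ 2 = (j : ℝ) * (h j / h k) ^ 2 := by field_simp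
  rw [e1, e2] at this
  exact this

/-- **THE CHORD OF `r ↦ r^{2∕3}`** without fractional powers: for `1 ≤ r ≤ M`, `(M³ − 1)·(r² − 1) ≥ (M² − 1)·(r³ − 1)` — a cube ratio `r³ ≥ c` on `[1, M³]`
yields the square ratio `r² ≥ 1 + ((M²−1)∕(M³−1))(c − 1)` (`M = 2`: slope `3∕7`).  Proof: the difference is
`(r−1)(M−r)(M−1)((M+1)r + M) ≥ 0`. [folklore] -/
theorem chord_cube_sq {r M : ℝ} (h1 : 1 ≤ r) (hrM : r ≤ M) :
    (M ^ 2 - 1) * (r ^ 3 - 1) ≤ (M ^ 3 - 1) * (r ^ 2 - 1) := by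
  -- (M³−1)(r²−1) − (M²−1)(r³−1) = (r−1)(M−r)(M−1)((M+1)r + M)
  have hr0 : 0 ≤ r - 1 := by linarith
  have hMr : 0 ≤ M - r := by linarith
  have hM1 : 0 ≤ M - 1 := by linarith
  have hlin : 0 ≤ (M + 1) * r + M := by nlinarith
  have key : (M ^ 3 - 1) * (r ^ 2 - 1) - (M ^ 2 - 1) * (r ^ 3 - 1) = (r - 1) * (M - r) * ((M - 1) * ((M + 1) * r + M)) := by
    ring
  nlinarith [key, mul_nonneg (mul_nonneg hr0 hMr) (mul_nonneg hM1 hlin)]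

end Summit.QuantumFields.BalabanUV.Beta.EriceRemainderEnclosureHistoryAutonomyComparisonCubeBudget

end
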